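import Mathlib
import Summits.Ventures.HodgeRepro2.BridgeCore

/-!
# BridgeDual — the bridge in the lead's cohomological form (PLAN.md §6.3 (b)) (Tier 4, T4-A)

Seat p4 of the blind cell pub-hodge-repro2 (README §6, T4-A). PLAN.md §6.3 (b) fixes the bridge
target in COHOMOLOGICAL form: the algebraic class `y := m_*([f(S)] × θ⁴) ∈ H⁴(B,ℚ)`, the projector
`p_W` onto the split Weil line `W = W_𝐅(B) ⊂ H⁴(B,ℚ)` (a ℚ-polynomial in algebraic correspondences),
the pairing identity `⟨y, θ⁸ ∪ w_σ⟩ = (non-zero constant) · ∫_S f^*w_σ`, the `θ⁸`-duality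
`L⁸ W = W′ ⊂ H^{20}(B,ℚ)`, and the line-hit. `BridgeCore.BridgeData` states the same bridge with the
surface class on the homology side; this file states it exactly as in §6.3 (b), so that route/TIER4.md
can cite one theorem per step:

* `CohomBridgeData`: `alg ≤ H⁴` (algebraic classes, an `R`-submodule), `weil = W` with its projector
  `e = p_W ∈ R`, `weil′ = W′ ⊂ H^{20}` on which `e` acts as the identity (the transposed projector),
  the Poincaré pairing `H⁴ × H^{20} → ℚ`, balanced, and the Lefschetz map `L⁸ : H⁴ → H^{20}` with
  `L⁸ W ⊆ W′`;
* `pair_e_smul`: `⟨e • y, w′⟩ = ⟨y, w′⟩` for `w′ ∈ W′` — the pairing with `W′` sees only `p_W(y)`;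
* `weil_le_alg_of_pair_ne_zero`: `y` algebraic and `⟨y, w′⟩ ≠ 0` for some `w′ ∈ W′` ⇒ `W ≤ alg`;
* `weil_le_alg_of_pair_lefschetz_ne_zero`: `y` algebraic and `⟨y, L⁸ w⟩ ≠ 0` for some `w ∈ W` ⇒
  `W ≤ alg` — §6.3 (b)(3)+(4) verbatim: `⟨y, θ⁸ ∪ w_σ⟩ ≠ 0` is (N), and then every class of `W_𝐅(B)`
  is algebraic.
-/

namespace Summit.Ventures.HodgeRepro2.BridgeDual

open Summit.Ventures.HodgeRepro2.BridgeCore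

variable (R : Type*) [CommRing R] (V : Type*) [AddCommGroup V] [Module R V]
  (V' : Type*) [AddCommGroup V'] [Module R V']

/-- **The bridge data in the cohomological form of PLAN §6.3 (b).** `V = H⁴(B,ℚ)`,
`V′ = H^{20}(B,ℚ)`, `R` = the algebra of correspondences (acting by pull-back on `V`, by the
transposed action on `V′`). -/
structure CohomBridgeData where
  /-- algebraic classes in `H⁴(B,ℚ)` (an `R`-submodule) -/
  alg : Submodule R V
  /-- the split Weil line `W_𝐅(B) ⊂ H⁴(B,ℚ)` -/
  weil : Submodule R V
  /-- the projector `p_W` onto the Weil line, as an element of the correspondence algebra -/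
  e : R
  /-- `p_W` maps `H⁴` into `W` -/
  e_smul_mem : ∀ v : V, e • v ∈ weil
  /-- `p_W` is the identity on `W` -/
  e_smul_eq : ∀ w ∈ weil, e • w = w
  /-- the dual Weil line `W′ ⊂ H^{20}(B,ℚ)` (`= L⁸ W`) -/
  weil' : Submodule R V'
  /-- the transposed projector is the identity on `W′` -/
  e_smul_eq' : ∀ w' ∈ weil', e • w' = w'
  /-- the Poincaré pairing `H⁴ × H^{20} → ℚ` -/
  pair : V → V' → ℚ
  /-- the pairing vanishes on `0` -/
  pair_zero_left : ∀ w', pair 0 w' = 0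
  /-- balance: `⟨r • y, w′⟩ = ⟨y, r • w′⟩` (pull-back is adjoint to push-forward) -/
  pair_balanced : ∀ (r : R) (y : V) (w' : V'), pair (r • y) w' = pair y (r • w')
  /-- the Lefschetz map `L⁸ = θ⁸ ∪ − : H⁴ → H^{20}` -/
  lefschetz : V → V'
  /-- the `θ⁸`-duality: `L⁸ W ⊆ W′` -/
  lefschetz_mem : ∀ w ∈ weil, lefschetz w ∈ weil'

variable {R V V'}

namespace CohomBridgeData

variable (D : CohomBridgeData R V V')

/-- The pairing with the dual Weil line sees only the Weil component: `⟨e • y, w′⟩ = ⟨y, w′⟩` for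
`w′ ∈ W′`. -/
theorem pair_e_smul (y : V) {w' : V'} (hw' : w' ∈ D.weil') : D.pair (D.e • y) w' = D.pair y w' := by
  rw [D.pair_balanced, D.e_smul_eq' w' hw']

/-- If the Weil component of `y` vanishes, so does every pairing of `y` with `W′`. -/
theorem pair_eq_zero_of_e_smul_eq_zero {y : V} (hy : D.e • y = 0) {w' : V'} (hw' : w' ∈ D.weil') :
    D.pair y w' = 0 := by
  rw [← D.pair_e_smul y hw', hy, D.pair_zero_left]

/-- **Line-hit, cohomological form** (§6.3 (b)(4)): an algebraic class with non-zero Weil component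
makes the whole Weil line algebraic. -/
theorem weil_le_alg_of_e_smul_ne_zero [IsSimpleModule R D.weil] {y : V} (hy : y ∈ D.alg)
    (hne : D.e • y ≠ 0) : D.weil ≤ D.alg := by
  apply le_of_inf_ne_bot
  intro hbot
  apply hne
  have hmem : D.e • y ∈ D.alg ⊓ D.weil := ⟨D.alg.smul_mem _ hy, D.e_smul_mem y⟩
  rw [hbot] at hmem
  exact (Submodule.mem_bot R).1 hmem

/-- **The bridge, cohomological form**: `y` algebraic and `⟨y, w′⟩ ≠ 0` for some `w′ ∈ W′` ⇒ every
class of the Weil line is algebraic. -/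
theorem weil_le_alg_of_pair_ne_zero [IsSimpleModule R D.weil] {y : V} (hy : y ∈ D.alg)
    (hnv : ∃ w' ∈ D.weil', D.pair y w' ≠ 0) : D.weil ≤ D.alg := by
  obtain ⟨w', hw', hne⟩ := hnv
  refine D.weil_le_alg_of_e_smul_ne_zero hy fun h0 => hne ?_
  exact D.pair_eq_zero_of_e_smul_eq_zero h0 hw'

/-- **PLAN §6.3 (b)(3)+(4) verbatim**: if `y` is algebraic and `⟨y, L⁸ w⟩ ≠ 0` for some `w ∈ W`
(the hypothesis (N): `⟨y, θ⁸ ∪ w_σ⟩ = c · ∫_S f^*w_σ ≠ 0`), then every class of `W_𝐅(B)` is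
algebraic. -/
theorem weil_le_alg_of_pair_lefschetz_ne_zero [IsSimpleModule R D.weil] {y : V} (hy : y ∈ D.alg)
    (hnv : ∃ w ∈ D.weil, D.pair y (D.lefschetz w) ≠ 0) : D.weil ≤ D.alg := by
  obtain ⟨w, hw, hne⟩ := hnv
  exact D.weil_le_alg_of_pair_ne_zero hy ⟨D.lefschetz w, D.lefschetz_mem w hw, hne⟩

/-- The converse direction of §6.3 (b)(3): if the Weil component of `y` vanishes then every pairing
`⟨y, L⁸ w⟩`, `w ∈ W`, vanishes — so `p_W(y) ≠ 0` is NECESSARY for (N). -/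
theorem pair_lefschetz_eq_zero_of_e_smul_eq_zero {y : V} (hy : D.e • y = 0) {w : V}
    (hw : w ∈ D.weil) : D.pair y (D.lefschetz w) = 0 :=
  D.pair_eq_zero_of_e_smul_eq_zero hy (D.lefschetz_mem w hw)

end CohomBridgeData

end Summit.Ventures.HodgeRepro2.BridgeDual
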